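import Literature.NumberTheory.Transcendental.DeRhamTheoremProofs
import Literature.Geometry.Manifold.DeRhamCupProduct
import HarnessLib

/-!
# De Rham's theorem is multiplicative: discharge of `exists_deRhamIsoFamily`

**Discharge of the named fact `Literature.NumberTheory.Transcendental.exists_deRhamIsoFamily`**
(de Rham's theorem in the tree's form: a natural, MULTIPLICATIVE and normalised de Rham
isomorphism family `H^k_dR(M; ℝ) ≃ₗ[ℝ] Hᵏ(M; ℝ)` over all Hausdorff σ-compact `C^∞` manifolds on a
finite-dimensional model vector space; Warner (1983), Thm. 5.36 / Thm. 5.45; Bredon (1993),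
Thm. V.9.5 with §VI.4; Bott–Tu (1982), Thm. 14.28).

The family is the integration family `integrationDeRhamIsoFamily E` of
`DeRhamTheoremProofs.lean` (`[α] ↦ [σ ↦ ∫_σ α]`), already known there to be natural and
normalised (`exists_deRhamIsoFamily_of_isMultiplicative` isolates multiplicativity as the only
missing clause). Its **multiplicativity** (`integrationDeRhamIsoFamily_isMultiplicative`:
`[α ∧ β] ↦ [α] ⌣ [β]`) is `Literature.Geometry.Manifold.deRhamComparisonIso_cup`
(`DeRhamCupProduct.lean`), proved through the Eilenberg–Zilber shuffle product: lift de Rham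
classes to singular cocycles that restrict exactly to integration cochains, test on smooth cycles,
`Δ_* z ∼ AW z` by the Eilenberg–Zilber/Alexander–Whitney homotopy and Stokes, and the analytic
core `∫_{σ × τ} pr₁^*α ∧ pr₂^*β = (∫_σ α)(∫_τ β)` (shuffle Fubini identity in collapsed-cube
coordinates).

Everything is proved; no named facts.

## References

* F. W. Warner, *Foundations of Differentiable Manifolds and Lie Groups*, GTM 94 (1983), Thm. 5.36, Thm. 5.45. [WarnerGTM94]
* G. E. Bredon, *Topology and Geometry*, GTM 139 (1993), Thm. V.9.5, §VI.4. [Bredon1993]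
* R. Bott, L. W. Tu, *Differential Forms in Algebraic Topology*, GTM 82 (1982), Thm. 14.28. [BottTu1982Forms]
-/

noncomputable section

-- see "Implementation notes" in `…SingularHomology.SingularChainsConcrete`
set_option backward.isDefEq.respectTransparency false

open scoped Manifold ContDiff Topology
open Literature.Geometry.Manifold Literature.Geometry.Kaehler

universe u

namespace Literature.NumberTheory.Transcendental

variable {E : Type u} [NormedAddCommGroup E] [NormedSpace ℝ E] [FiniteDimensional ℝ E]

/-- **The integration de Rham isomorphism family is multiplicative**: `[α ∧ β] ↦ [α] ⌣ [β]`
(Warner (1983), Thm. 5.45; Bredon (1993), Thm. V.9.5 with §VI.4; Bott–Tu (1982), Thm. 14.28). [cite: WarnerGTM94, Thm. 5.45] -/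
theorem integrationDeRhamIsoFamily_isMultiplicative : (integrationDeRhamIsoFamily E).IsMultiplicative := by
  intro M _ _ _ _ _ _ k l m h a b
  subst h
  rw [integrationDeRhamIsoFamily_apply, integrationDeRhamIsoFamily_apply, integrationDeRhamIsoFamily_apply]
  haveI : SecondCountableTopology M := secondCountableTopology_of_sigmaCompact E M
  haveI : LocallyCompactSpace M := locallyCompactSpace_of_chartedSpace E M
  exact deRhamComparisonIso_cup k l a b

variable (E) in
/-- **de Rham's theorem** — discharge of the named fact `exists_deRhamIsoFamily` for the
boundaryless model `𝓘(ℝ, E)`, `E` finite-dimensional: the integration family is natural,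
multiplicative and normalised (Warner (1983), Thm. 5.36 / Thm. 5.45). [cite: WarnerGTM94, Thm. 5.36 / Thm. 5.45] -/
theorem exists_deRhamIsoFamily_holds : exists_deRhamIsoFamily 𝓘(ℝ, E) :=
  exists_deRhamIsoFamily_of_isMultiplicative integrationDeRhamIsoFamily_isMultiplicative

end Literature.NumberTheory.Transcendental
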